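import Mathlib
import HarnessLib
import Literature.Computability.AlgebraicComplexity.ArithCircuitProofs
import Literature.Computability.AlgebraicComplexity.ValiantClasses
import Summits.ValiantsHypothesis.ValiantsHypothesis.Theorems.MonotoneRestorationNonnegRestorationQPSmlAffineSize

/-!
# Affine column-set-multilinear families are a CERTIFIED SUB-CASE of `NonnegRestorationQP` (and are `VP` families)
(route MonotoneRestoration, crux `NonnegRestorationQP` stmt-ValiantsHypothesis-16191; also `OrbitRestorationQP` 18293)

`…NonnegRestorationQPSmlAffineSize.lean` proved the CONCLUSION of `NonnegRestorationQP` (square-symmetric circuits of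
quasi-polynomial SIZE) for matrix-symmetric nonnegative families whose complexification has an affine column-set-multilinear
`ΣΠΣ` expression with at most `n^c + c` product gates.  Here we check the crux's HYPOTHESIS for the same class — the
complexification is a `VP` family (tree `IsVPFamily`: polynomially many variables, polynomial degree, polynomial complexity) — so
the class is an honest sub-case ON WHICH THE CRUX HOLDS:

* `complexity_affineColSml_le` — over any commutative semiring, `L(Σ_{t<s} Π_b (β_{t,b} + Σ_a α_{t,b,a} x_{(a,b)})) ≤ s (2n² + 2n + 1)`;
* `totalDegree_affineColSml_le` — the degree is `≤ n`;
* `isVPFamily_of_affineColSml` — **a family over `ℂ` with affine column-sml expressions of at most `n^c + c` product gates is a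
  `VP` family** (so the affine stratum of A_∞ lies inside the hypothesis class of the orbit crux `OrbitRestorationQP` as well);
* `nonnegRestorationQP_on_affineColSml` — **`NonnegRestorationQP` HOLDS on the class**: hypothesis (`IsVPFamily` of the
  complexification) and conclusion together.

Honest label: a certified sub-case of an open crux; no registered stub of 16191 is closed; VP ≠ VNP untouched. [folklore]
-/

noncomputable section

open scoped Classical

-- `Summit.ValiantsHypothesis.ValiantsHypothesis.…` is the tree's single-conjunct layout (Sub = Summit).
set_option linter.dupNamespace false

namespace Summit.ValiantsHypothesis.ValiantsHypothesis.Theorems.SmlAffineRestoration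

open MvPolynomial Finset Equiv Literature.Computability.AlgebraicComplexity OrbitRestorationQPDepthThreeRung

universe u

/-! ### Complexity and degree of an affine column-sml expression (any commutative semiring) -/

/-- An affine column form costs at most `2n + 1` gates. [folklore] -/
theorem complexity_affineForm_le {k : Type u} [CommSemiring k] {n : ℕ} (γ : k) (β : Fin n → k) (b : Fin n) :
    complexity (C γ + ∑ a : Fin n, C (β a) * X (a, b) : MvPolynomial (Fin n × Fin n) k) ≤ 2 * n + 1 := by
  have hterm : ∀ a : Fin n, complexity (C (β a) * X (a, b) : MvPolynomial (Fin n × Fin n) k) ≤ 1 := by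
    intro a
    calc complexity (C (β a) * X (a, b) : MvPolynomial (Fin n × Fin n) k)
        ≤ complexity (C (β a) : MvPolynomial (Fin n × Fin n) k) +
            complexity (X (a, b) : MvPolynomial (Fin n × Fin n) k) + 1 := complexity_mul_le_holds _ _
      _ = 1 := by rw [complexity_C_holds, complexity_X_holds]
  have hsum : complexity (∑ a : Fin n, C (β a) * X (a, b) : MvPolynomial (Fin n × Fin n) k) ≤ 2 * n := by
    refine (complexity_finset_sum_le _ _).trans ?_
    calc ∑ a : Fin n, complexity (C (β a) * X (a, b) : MvPolynomial (Fin n × Fin n) k) + (Finset.univ : Finset (Fin n)).card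
        ≤ ∑ _a : Fin n, 1 + (Finset.univ : Finset (Fin n)).card := by gcongr with a _; exact hterm a
      _ = 2 * n := by simp; ring
  calc complexity (C γ + ∑ a : Fin n, C (β a) * X (a, b) : MvPolynomial (Fin n × Fin n) k)
      ≤ complexity (C γ : MvPolynomial (Fin n × Fin n) k) +
          complexity (∑ a : Fin n, C (β a) * X (a, b) : MvPolynomial (Fin n × Fin n) k) + 1 :=
        complexity_add_le_holds _ _
    _ ≤ 0 + 2 * n + 1 := by rw [complexity_C_holds]; gcongr
    _ = 2 * n + 1 := by ring

/-- **Complexity of an affine column-sml expression**: `≤ s (2n² + 2n + 1)`. [folklore] -/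
theorem complexity_affineColSml_le {k : Type u} [CommSemiring k] {n s : ℕ} (β : Fin s → Fin n → k)
    (α : Fin s → Fin n → Fin n → k) :
    complexity (∑ t : Fin s, ∏ b : Fin n, (C (β t b) + ∑ a : Fin n, C (α t b a) * X (a, b)) :
      MvPolynomial (Fin n × Fin n) k) ≤ s * (2 * n * n + 2 * n + 1) := by
  have hprod : ∀ t : Fin s, complexity (∏ b : Fin n, (C (β t b) + ∑ a : Fin n, C (α t b a) * X (a, b)) :
      MvPolynomial (Fin n × Fin n) k) ≤ 2 * n * n + 2 * n := by
    intro t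
    refine (complexity_finset_prod_le _ _).trans ?_
    calc ∑ b : Fin n, complexity (C (β t b) + ∑ a : Fin n, C (α t b a) * X (a, b) : MvPolynomial (Fin n × Fin n) k) +
          (Finset.univ : Finset (Fin n)).card
        ≤ ∑ _b : Fin n, (2 * n + 1) + (Finset.univ : Finset (Fin n)).card := by
          gcongr with b _; exact complexity_affineForm_le _ _ _
      _ = 2 * n * n + 2 * n := by simp; ring
  refine (complexity_finset_sum_le _ _).trans ?_
  calc ∑ t : Fin s, complexity (∏ b : Fin n, (C (β t b) + ∑ a : Fin n, C (α t b a) * X (a, b)) :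
          MvPolynomial (Fin n × Fin n) k) + (Finset.univ : Finset (Fin s)).card
      ≤ ∑ _t : Fin s, (2 * n * n + 2 * n) + (Finset.univ : Finset (Fin s)).card := by gcongr with t _; exact hprod t
    _ = s * (2 * n * n + 2 * n + 1) := by simp; ring

/-- **Degree of an affine column-sml expression over `ℂ`**: `≤ n`. [folklore] -/
theorem totalDegree_affineColSml_le {n s : ℕ} (β : Fin s → Fin n → ℂ) (α : Fin s → Fin n → Fin n → ℂ) :
    (∑ t : Fin s, ∏ b : Fin n, (C (β t b) + ∑ a : Fin n, C (α t b a) * X (a, b)) :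
      MvPolynomial (Fin n × Fin n) ℂ).totalDegree ≤ n := by
  refine totalDegree_finsetSum_le fun t _ => (totalDegree_finsetProd _ _).trans ?_
  calc ∑ b : Fin n, (C (β t b) + ∑ a : Fin n, C (α t b a) * X (a, b) : MvPolynomial (Fin n × Fin n) ℂ).totalDegree
      ≤ ∑ _b : Fin n, 1 := Finset.sum_le_sum fun b _ => SmlAffineNarrow.totalDegree_affineForm_le _ _ _
    _ = n := by simp

/-! ### The class lies in `VP` -/

/-- **Families with small affine column-sml expressions are `VP` families.** [folklore] -/
theorem isVPFamily_of_affineColSml (f : (n : ℕ) → MvPolynomial (Fin n × Fin n) ℂ) {c : ℕ}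
    (hcirc : ∀ n : ℕ, ∃ (s : ℕ) (β : Fin s → Fin n → ℂ) (α : Fin s → Fin n → Fin n → ℂ), s ≤ n ^ c + c ∧
      f n = ∑ t : Fin s, ∏ b : Fin n, (C (β t b) + ∑ a : Fin n, C (α t b a) * X (a, b))) :
    IsVPFamily f := by
  refine ⟨⟨?_, ?_⟩, ?_⟩
  · -- number of variables `n · n`
    refine IsPBounded.mono (IsPBounded.mul_holds IsPBounded.id IsPBounded.id) fun n => ?_
    simp
  · -- degree `≤ n`
    refine IsPBounded.mono IsPBounded.id fun n => ?_
    obtain ⟨s, β, α, _, hf⟩ := hcirc n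
    rw [hf]
    exact totalDegree_affineColSml_le β α
  · -- complexity `≤ (n^c + c)(2n² + 2n + 1)`
    have hb : IsPBounded fun n => (n ^ c + c) * (2 * n * n + 2 * n + 1) :=
      IsPBounded.mul_holds ⟨c, fun n => le_rfl⟩
        (IsPBounded.add_holds (IsPBounded.add_holds
          (IsPBounded.mul_holds (IsPBounded.mul_holds (IsPBounded.const 2) IsPBounded.id) IsPBounded.id)
          (IsPBounded.mul_holds (IsPBounded.const 2) IsPBounded.id)) (IsPBounded.const 1))
    refine IsPBounded.mono hb fun n => ?_
    obtain ⟨s, β, α, hs, hf⟩ := hcirc n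
    rw [hf]
    exact (complexity_affineColSml_le β α).trans (Nat.mul_le_mul_right _ hs)

/-- **`NonnegRestorationQP` HOLDS ON THE CLASS OF MATRIX-SYMMETRIC NONNEGATIVE FAMILIES WITH SMALL AFFINE COLUMN-SML
COMPLEXIFICATIONS**: the complexification is a `VP` family (the crux's hypothesis) AND square-symmetric circuits of quasi-polynomial
size computing it exist (the crux's conclusion). [folklore] -/
theorem nonnegRestorationQP_on_affineColSml (h : (n : ℕ) → MvPolynomial (Fin n × Fin n) NNReal)
    (hsym : ∀ (n : ℕ) (σ τ : Equiv.Perm (Fin n)),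
      MvPolynomial.rename (fun p : Fin n × Fin n => (σ p.1, τ p.2)) (h n) = h n)
    (hcirc : ∃ c : ℕ, ∀ n : ℕ, ∃ (s : ℕ) (β : Fin s → Fin n → ℂ) (α : Fin s → Fin n → Fin n → ℂ), s ≤ n ^ c + c ∧
      MvPolynomial.map (Complex.ofRealHom.comp NNReal.toRealHom) (h n) =
        ∑ t : Fin s, ∏ b : Fin n, (C (β t b) + ∑ a : Fin n, C (α t b a) * X (a, b))) :
    IsVPFamily (fun n => MvPolynomial.map (Complex.ofRealHom.comp NNReal.toRealHom) (h n)) ∧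
    ∃ c : ℕ, ∀ n : ℕ, ∃ (G : Type) (_ : Fintype G) (C : LabelledArithCircuit ℂ (Fin n × Fin n) Unit G),
      C.IsSymmetric (Equiv.Perm (Fin n)) ∧
      C.eval (C.output ()) = MvPolynomial.map (Complex.ofRealHom.comp NNReal.toRealHom) (h n) ∧
      Fintype.card G ≤ 2 ^ ((Nat.log 2 n + c) ^ c) := by
  obtain ⟨c, hc⟩ := hcirc
  exact ⟨isVPFamily_of_affineColSml _ hc, nonneg_affineColSml_symmetricSize h hsym ⟨c, hc⟩⟩

end Summit.ValiantsHypothesis.ValiantsHypothesis.Theorems.SmlAffineRestoration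

end
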